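import Literature.NumberTheory.Automorphic.TorusDeepOrbitalIntegralStrata             -- ★ p846544 (O2) (p04 (g17)): `classOrbitalIntegral_eq_mul_rankStrata_of_torus_deep`; brings ★ FILE D, ★ FILE C
import Literature.NumberTheory.Rogawski1990.DepthZeroTransferHValuesLevi                  -- ★ p846593∕p846606 (O3) L-δ (p07 (g12)): `classOrbitalIntegral_chiZero∕One_eq_of_torus_deep`
import Literature.NumberTheory.Rogawski1990.LeviTransferPrefactor                        -- ★ p846585 (O4): `levi_prefactor_eq`
import Literature.NumberTheory.Rogawski1990.LeviNearOneDeep                              -- ★ p846586 (O1) (p04 (g17)): `exists_nhds_one_forall_levi_deep`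
import Literature.NumberTheory.Rogawski1990.LocalDeltaTransferLeviStratum                   -- ★ one-term sockets on the Levi stratum; brings ★ `UnitFundamentalLemmaInertLevi`, ★ `FinExplicitTransferFactorLeviStratum`
import Literature.NumberTheory.Rogawski1990.UnitFundamentalLemmaInertLeviClause             -- ★ `isLocalGRegular_conj_iff`, `charpoly_map_endoEmbLocal_conj`, `mem_prod_cmLocalIntegralLevel_of_levi_of_integral_charpoly`
import Literature.NumberTheory.Rogawski1990.UnitFundamentalLemmaInertVanishing              -- ★ `finExplicitCollection_Δ_eq_of_isLocalStablyConjH` (via ★ `FinExplicitTransferFactorStableInvariance`)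
import Literature.NumberTheory.Rogawski1990.LocalTransferExplicitNonsplit                   -- the letter's tokens (`finExplicitCollection`, `finExplicitDelta_conj_left∕right_all`), as in the END fold
import Literature.NumberTheory.Rogawski1990.LocalTransferAtOneOfPopulations                 -- ★ p846349 END junction (same import set as the fold that registers `stub_T3prime_levi`)
import HarnessLib

/-!
# T3′ HEAD v4, CLAUSE (P-3) «LEVI»: the depth-zero κ-transfer at the hyperspecial vertex on the Levi classes — `stub_T3prime_levi` DISCHARGED
(Rogawski (1990) §4.9 Prop. 4.9.1 (b), (4.9.2) p. 55; §4.3 (4.3.1) p. 43; §4.1 (4.1.1) p. 40; Kottwitz (1986) §3, §7; Flicker (1998) §2)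

Topic `NumberTheory/Rogawski1990`; namespace `Literature.NumberTheory.Rogawski1990`.  THEOREMS ONLY (no definition, no instance, no notation, no named fact, no `sorry`).
Cell `pub/hodgecm-mathlib`, crux H413 = `stmt-HodgeConjecture-24833`, road «S3-tree» (architect A-p16 (g30): A-102, A-108, A-149, A-157), brick T3′ «DEPTH-ZERO κ-TRANSFER»,
population P-3 «LEVI»: the END fold's `stub_T3prime_levi` (F0P3a-p03, `LocalTransferAtOneHyperspecialLevelOne.fold` v1-le1 82802cfb :177–:242) proved VERBATIM as
`depthZeroKappaTransfer_hyperspecial_levi`.  Assembly F0P3a-p01 (g15) over the organs of F0P3a-p04 (g16∕g17) ((O1) ★ `LeviNearOneDeep`, (O2) ★ `TorusDeepOrbitalIntegralStrata`,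
(O4) ★ `LeviTransferPrefactor`, FILES A–D, algebra) and F0P3a-p07 (g12) ((O3) ★ `DepthZeroTransferHValuesLevi`); recipe F0P3a-p04 (g16) `ASSEMBLY-T3prime-P3-Levi` 291f01d0.
HONEST LABEL: HC_CM is proved only modulo the cell's 2 remaining named inputs (hLiu418 24832, h413 24833) until rung 0 closes; this file is unconditional and pays one
population clause of the waypoint `localTransferAtOne_of_hyperspecialLevel_le_one`, nothing by itself.

THE MATHEMATICS.  `L` CM, `v` a finite place of `L⁺` NON-SPLIT and UNRAMIFIED in `L`, `v ∤ 2`, `H′` hermitian of good reduction at `w ∣ v`; `H_v = U(Φ₂)(L⁺_v) × U(Φ₁)(L⁺_v)`,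
`G′_v = U(H′)(L⁺_v)`, hyperspecial `K_H`, `K′`; canonical orbital measure families `m_H`, `m_G` for right-invariant Haar `ν_H`, `ν_G`; `Δ‴_v` Rogawski's explicit transfer
factor (★ `finExplicitCollection`); `g ∈ C_c^∞(G′_v)` a DEPTH-ZERO PIECE: supported in `K′`, `Ad K′`-invariant, `= c r` on the residually-unipotent Jordan stratum
`rank(red k_w − 1) = r` of `K′`.  CLAIM: for `γ_H` near `1`, `G`-regular and `H_v`-conjugate to a Levi element (`(yγ_Hy⁻¹)₁ = diag(d′₀, d′₁)`),
`Σ_{c} Δ‴(γ_H, c)·Φ(c, g) = a₀·Φ^st(γ_H, χ₀) + a₁·Φ^st(γ_H, χ₁)` with HEAD v4's coefficients `a_s` and residual class functions `χ_s` on `H_v`.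
PROOF (§3).  (T) Both sides are stable class functions of `γ_H` (★ `stableOrbitalIntegralRel_congr`, ★ `finExplicitCollection_Δ_eq_of_isLocalStablyConjH`): pass to
`γ₁ = yγ_Hy⁻¹ = (diag(d′), u)`.  (O1) For `γ_H` in the residually-unipotent neighbourhood of `1` the eigenvalues `d = (d′₀, u, d′₁)` of `ι_v(γ₁)` are `≡ 1 (mod 𝔪_w)` (★
`exists_nhds_one_forall_levi_deep`); `G`-regularity makes `dᵢ − dⱼ` units (★ `isUnit_levi_of_isLocalGRegular_of_nonsplit`), deepness makes `χ_{ι(γ₁),w}` integral so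
`γ₁ ∈ K_H`, `t := ι_v(γ₁) ∈ T ∩ K₃` (★ `mem_prod_cmLocalIntegralLevel_of_levi_of_integral_charpoly`).  (L) With the level-preserving Jacobowitz frame `ψ : G′_v ≃ U(Φ₃)(L⁺_v)`
(★ `exists_continuousMulEquiv_level_formCongr_of_nonsplit`) and `γ₀ := ψ⁻¹(t)`, every match of `γ₁` is conjugate to `γ₀` (★ `isConj_of_isLocalNormPair_of_isLocalNormPair_of_levi`),
so the left side is ONE term `Δ‴(γ₁, γ₀)·Φ(⟦γ₀⟧, g)` (★ `finsum_delta_mul_classOrbitalIntegral_eq_of_unique`) with `Δ‴ = ‖a − 1‖`, `a = d′₀⁻¹u` (★ T5-Levi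
`finExplicitDelta_eq_unitModulusChar_of_levi_of_nonsplit`) and `Φ(⟦γ₀⟧, g) = ν_G(K′)·J₃(t)·q⁻³(c₀ + c₁(q−1) + c₂(q³−q))` (★ (O2)).  (R) The `H`-stable class of `γ₁` is one
class (★ `isConj_of_isLocalStablyConjH_of_levi`), so `Φ^st(γ₁, χ_s) = Φ(⟦γ₁⟧, χ_s) = ν_H(K_H)·J_H(t₂)·q⁻¹·(1, q−1)_s` (★ (O3), §2).  (A) `‖a − 1‖·J₃(t) = J_H(t₂)` (★ (O4)) and the
scalar identity `q⁻³(c₀ + c₁(q−1) + c₂(q³−q)) = q⁻¹(a₀′ + a₁′(q−1))` (§1; ★ p846176 `depthZero_matrix_identity_levi`).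
ELABORATION NOTE.  On this goal `rw`∕`set`∕`obtain … := ‹term›` exhaust any heartbeat budget (the post-`rw` `rfl` attempt unfolds `ℂ`∕`ℝ` arithmetic of the Iwasawa modules; motive
type-checks over the CM carriers): the assembly therefore moves only by `refine h.trans ?_`, `congrArg₂`, `have h := ‹term›; obtain … := h`, and closes by `exact` of §1.

## References
* [Rogawski1990] J. D. Rogawski, *Automorphic Representations of Unitary Groups in Three Variables*, Ann. of Math. Stud. 123 (1990): §4.9 Prop. 4.9.1 (b), (4.9.2)
  pp. 54–56; §4.3 (4.3.1) p. 43; §4.1 (4.1.1) pp. 39–40.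
* [Kottwitz1986] R. E. Kottwitz, *Base change for unit elements of Hecke algebras*, Compositio Math. 60 (1986): §3, §7.
* [Flicker1998UnitaryFL] Y. Z. Flicker, *Elementary proof of the fundamental lemma for a unitary group*, Canad. J. Math. 50 (1998), §2.
* [LanglandsShelstad1987] R. P. Langlands, D. Shelstad, *On the definition of transfer factors*, Math. Ann. 278 (1987), §1.3–1.4.
-/

set_option autoImplicit false

noncomputable section

open NumberField IsDedekindDomain MeasureTheory Measure Topology Filter
open Literature.NumberTheory.Rogawski1990 Literature.NumberTheory.Automorphic Literature.NumberTheory.GaloisRepresentations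
open Literature.NumberTheory.Automorphic.UnitaryGroup Literature.NumberTheory.Automorphic.IntegralReduction
open Literature.AlgebraicGeometry.ShimuraVarieties (unitaryGroup hermForm)
open scoped Matrix MatrixGroups Classical ValuativeRel NNReal ENNReal

namespace Literature.NumberTheory.Rogawski1990


/-! ## §1 The scalar identity of the Levi clause -/

section Generic

/-- **The scalar identity behind the Levi clause** (★ p846176 `Flicker1998.depthZero_matrix_identity_levi` in the assembly's currency): with `Δ‴·J₃ = J_H` (`h`, read in
`ℂ`), `q ≠ 0`, `ν_H(K_H) ≠ 0`, the one-term left side `Δ‴ · ν_G(K′) · J₃ · q⁻³(c₀ + c₁(q−1) + c₂(q³−q))` equals HEAD v4's two-term right side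
`(ν_G(K′)∕ν_H(K_H))·(q⁻²c₀ + ((q²−1)∕q²)c₁)·(ν_H(K_H)·J_H·q⁻¹) + (ν_G(K′)∕ν_H(K_H))·(−q⁻¹c₁ + ((q+1)∕q)c₂)·(ν_H(K_H)·J_H·q⁻¹(q−1))`. [cite: Flicker1998UnitaryFL, §2] -/
theorem levi_clause_scalar_identity (q : ℂ) (N M : ℝ) (α J S : ℝ≥0) (c0 c1 c2 : ℂ) (hq : q ≠ 0) (hM : (M : ℂ) ≠ 0)
    (h : ((α : ℝ) : ℂ) * ((J : ℝ) : ℂ) = ((S : ℝ) : ℂ)) :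
    ((α : ℝ) : ℂ) * ((N : ℂ) * ((J : ℝ) : ℂ) * ((q ^ 3)⁻¹ * (c0 * 1 + c1 * (q - 1) + c2 * (q ^ 3 - q)))) =
      ((N / M : ℝ) : ℂ) * ((q ^ 2)⁻¹ * c0 + ((q ^ 2 - 1) / q ^ 2) * c1) * ((M : ℂ) * ((S : ℝ) : ℂ) * q⁻¹) +
      ((N / M : ℝ) : ℂ) * (-q⁻¹ * c1 + ((q + 1) / q) * c2) * ((M : ℂ) * ((S : ℝ) : ℂ) * (q⁻¹ * (q - 1))) := by
  rw [← h]
  push_cast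
  field_simp
  ring

end Generic

/-! ## §2 (O3) The `H`-side values of L-δ (★ F0P3a-p07 (g12)) read at the class of a Levi element of `H_v` -/

section HSide

set_option maxHeartbeats 800000 in
-- instance-term unification on the CM local carriers (pattern of ★ `DepthZeroTransferHValuesLevi`)
/-- **(O3) L-δ's `H`-side value (χ₀) at the class of a whole `γ_H ∈ H_v` with `γ_H.1 = diag(d)` regular and deep** (`u := γ_H.2`; `(⟨γ_H.1, _⟩, γ_H.2) = γ_H` by eta):
★ F0P3a-p07 (g12) `classOrbitalIntegral_chiZero_eq_of_torus_deep` at `t := ⟨γ_H.1, ⟨d, hd⟩⟩` — the shape the assembly consumes for `γ₁ = yγ_Hy⁻¹` without unfolding the product group law.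
[cite: Rogawski1990, §4.9 Prop. 4.9.1 (b) p. 55; §4.3 (4.3.1) p. 43] [cite: Flicker1998UnitaryFL, §2] -/
theorem classOrbitalIntegral_chiZero_eq_of_levi_deep
    (L : Type) [Field L] [NumberField L] [IsCMField L] (v : HeightOneSpectrum (𝓞 ↥(maximalRealSubfield L)))
    (w : PlacesOver L v) (hw : IsCMField.complexConj L • w.1 = w.1)
    [MeasurableSpace ((cmDatum L 2 (Matrix.of fun i j : Fin 2 => if i.val + j.val + 1 = 2 then (1 : L) else 0)).Local v × (cmDatum L 1 (Matrix.of fun i j : Fin 1 => if i.val + j.val + 1 = 1 then (1 : L) else 0)).Local v)] [BorelSpace ((cmDatum L 2 (Matrix.of fun i j : Fin 2 => if i.val + j.val + 1 = 2 then (1 : L) else 0)).Local v × (cmDatum L 1 (Matrix.of fun i j : Fin 1 => if i.val + j.val + 1 = 1 then (1 : L) else 0)).Local v)]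
    [∀ a : ((cmDatum L 2 (Matrix.of fun i j : Fin 2 => if i.val + j.val + 1 = 2 then (1 : L) else 0)).Local v × (cmDatum L 1 (Matrix.of fun i j : Fin 1 => if i.val + j.val + 1 = 1 then (1 : L) else 0)).Local v), MeasurableSpace (((cmDatum L 2 (Matrix.of fun i j : Fin 2 => if i.val + j.val + 1 = 2 then (1 : L) else 0)).Local v × (cmDatum L 1 (Matrix.of fun i j : Fin 1 => if i.val + j.val + 1 = 1 then (1 : L) else 0)).Local v) ⧸ Subgroup.centralizer ({a} : Set ((cmDatum L 2 (Matrix.of fun i j : Fin 2 => if i.val + j.val + 1 = 2 then (1 : L) else 0)).Local v × (cmDatum L 1 (Matrix.of fun i j : Fin 1 => if i.val + j.val + 1 = 1 then (1 : L) else 0)).Local v)))]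
    [∀ a : ((cmDatum L 2 (Matrix.of fun i j : Fin 2 => if i.val + j.val + 1 = 2 then (1 : L) else 0)).Local v × (cmDatum L 1 (Matrix.of fun i j : Fin 1 => if i.val + j.val + 1 = 1 then (1 : L) else 0)).Local v), BorelSpace (((cmDatum L 2 (Matrix.of fun i j : Fin 2 => if i.val + j.val + 1 = 2 then (1 : L) else 0)).Local v × (cmDatum L 1 (Matrix.of fun i j : Fin 1 => if i.val + j.val + 1 = 1 then (1 : L) else 0)).Local v) ⧸ Subgroup.centralizer ({a} : Set ((cmDatum L 2 (Matrix.of fun i j : Fin 2 => if i.val + j.val + 1 = 2 then (1 : L) else 0)).Local v × (cmDatum L 1 (Matrix.of fun i j : Fin 1 => if i.val + j.val + 1 = 1 then (1 : L) else 0)).Local v)))]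
    (νH : Measure ((cmDatum L 2 (Matrix.of fun i j : Fin 2 => if i.val + j.val + 1 = 2 then (1 : L) else 0)).Local v × (cmDatum L 1 (Matrix.of fun i j : Fin 1 => if i.val + j.val + 1 = 1 then (1 : L) else 0)).Local v)) [νH.IsHaarMeasure] [νH.IsMulRightInvariant]
    {P_H : ((cmDatum L 2 (Matrix.of fun i j : Fin 2 => if i.val + j.val + 1 = 2 then (1 : L) else 0)).Local v × (cmDatum L 1 (Matrix.of fun i j : Fin 1 => if i.val + j.val + 1 = 1 then (1 : L) else 0)).Local v) → Prop} {mH : OrbitalMeasureFamily ((cmDatum L 2 (Matrix.of fun i j : Fin 2 => if i.val + j.val + 1 = 2 then (1 : L) else 0)).Local v × (cmDatum L 1 (Matrix.of fun i j : Fin 1 => if i.val + j.val + 1 = 1 then (1 : L) else 0)).Local v)} (hmH : mH.IsCanonical P_H νH)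
    (hv : Algebra.IsUnramifiedIn (𝓞 L) v.asIdeal)
    (γH : ((cmDatum L 2 (Matrix.of fun i j : Fin 2 => if i.val + j.val + 1 = 2 then (1 : L) else 0)).Local v × (cmDatum L 1 (Matrix.of fun i j : Fin 1 => if i.val + j.val + 1 = 1 then (1 : L) else 0)).Local v)) {d : Fin 2 → (LocalRing L v)ˣ}
    (hd : glDiagonal 2 (LocalRing L v) d = (γH.1.val : GL (Fin 2) (LocalRing L v)))
    (hb : IsUnit ((((d 0)⁻¹ * d 1 : (LocalRing L v)ˣ) : LocalRing L v) - 1))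
    (hreg₂ : IsRegularElt (γH.1.val : GL (Fin 2) (LocalRing L v)))
    (ht1 : ∀ i : Fin 2, Valued.v ((((d i : (LocalRing L v)ˣ) : LocalRing L v) w) - 1) < 1)
    (hPH : P_H (Quotient.out (ConjClasses.mk γH)))
    (hK₁ : ∀ x : (cmDatum L 1 (Matrix.of fun i j : Fin 1 => if i.val + j.val + 1 = 1 then (1 : L) else 0)).Local v, x ∈ cmLocalIntegralLevel L 1 (Matrix.of fun i j : Fin 1 => if i.val + j.val + 1 = 1 then (1 : L) else 0) v) :
    classOrbitalIntegral mH (((((cmLocalIntegralLevel L 2 (Matrix.of fun i j : Fin 2 => if i.val + j.val + 1 = 2 then (1 : L) else 0) v).prod (cmLocalIntegralLevel L 1 (Matrix.of fun i j : Fin 1 => if i.val + j.val + 1 = 1 then (1 : L) else 0) v)) : Subgroup ((cmDatum L 2 (Matrix.of fun i j : Fin 2 => if i.val + j.val + 1 = 2 then (1 : L) else 0)).Local v × (cmDatum L 1 (Matrix.of fun i j : Fin 1 => if i.val + j.val + 1 = 1 then (1 : L) else 0)).Local v)) : Set ((cmDatum L 2 (Matrix.of fun i j : Fin 2 => if i.val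 + j.val + 1 = 2 then (1 : L) else 0)).Local v × (cmDatum L 1 (Matrix.of fun i j : Fin 1 => if i.val + j.val + 1 = 1 then (1 : L) else 0)).Local v)).indicator fun h => if (redMat ((((h).1.val : GL (Fin 2) (UnitaryGroup.LocalRing L v)).val.map (Pi.evalRingHom (fun w' : PlacesOver L v => w'.1.adicCompletion L) w))) - 1) ^ 2 = 0 ∧ (redMat ((((h).1.val : GL (Fin 2) (UnitaryGroup.LocalRing L v)).val.map (Pi.evalRingHom (fun w' : PlacesOver L v => w'.1.adicCompletion L) w))) - 1).rank = 0 then (1 : ℂ) else 0)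
        (ConjClasses.mk γH) =
      (νH.real ((((cmLocalIntegralLevel L 2 (Matrix.of fun i j : Fin 2 => if i.val + j.val + 1 = 2 then (1 : L) else 0) v).prod (cmLocalIntegralLevel L 1 (Matrix.of fun i j : Fin 1 => if i.val + j.val + 1 = 1 then (1 : L) else 0) v)) : Subgroup ((cmDatum L 2 (Matrix.of fun i j : Fin 2 => if i.val + j.val + 1 = 2 then (1 : L) else 0)).Local v × (cmDatum L 1 (Matrix.of fun i j : Fin 1 => if i.val + j.val + 1 = 1 then (1 : L) else 0)).Local v)) : Set ((cmDatum L 2 (Matrix.of fun i j : Fin 2 => if i.val + j.val + 1 = 2 then (1 : L) else 0)).Local v × (cmDatum L 1 (Matrix.of fun i j : Fin 1 => if i.val + j.val + 1 = 1 then (1 : L) else 0)).Local v)) : ℂ) *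
        ((((letI : MeasurableSpace (LocalRing L v) := borel _; haveI : BorelSpace (LocalRing L v) := ⟨rfl⟩
          haveI : SecondCountableTopology (LocalRing L v) := secondCountableTopology_localRing (E := L) v
          ((HeisRing.skewModulus (conjLocal L (IsCMField.complexConj L) v) (continuous_conjLocal L (IsCMField.complexConj L) v) hb.unit
            (LineRing.map_unit_torusScalar_sub_one_two (conjLocal L (IsCMField.complexConj L) v) (cmLocalForm_eq_over L 2 v)
              (⟨(γH).1, ⟨d, hd⟩⟩ : ↥(torusU (conjLocal L (IsCMField.complexConj L) v) (cmLocalForm L 2 v))) hd hb))⁻¹ : ℝ≥0)) : ℝ≥0) : ℝ) : ℂ) *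
        ((Ideal.absNorm v.asIdeal : ℂ))⁻¹ :=
  classOrbitalIntegral_chiZero_eq_of_torus_deep L v w hw νH hmH hv ⟨γH.1, ⟨d, hd⟩⟩ hd hb hreg₂ ht1 γH.2 hPH hK₁ _

set_option maxHeartbeats 800000 in
-- instance-term unification on the CM local carriers (pattern of ★ `DepthZeroTransferHValuesLevi`)
/-- **(O3) L-δ's `H`-side value (χ₁) at the class of a whole `γ_H ∈ H_v` with `γ_H.1 = diag(d)` regular and deep** (`u := γ_H.2`; `(⟨γ_H.1, _⟩, γ_H.2) = γ_H` by eta):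
★ F0P3a-p07 (g12) `classOrbitalIntegral_chiOne_eq_of_torus_deep` at `t := ⟨γ_H.1, ⟨d, hd⟩⟩` — the shape the assembly consumes for `γ₁ = yγ_Hy⁻¹` without unfolding the product group law.
[cite: Rogawski1990, §4.9 Prop. 4.9.1 (b) p. 55; §4.3 (4.3.1) p. 43] [cite: Flicker1998UnitaryFL, §2] -/
theorem classOrbitalIntegral_chiOne_eq_of_levi_deep
    (L : Type) [Field L] [NumberField L] [IsCMField L] (v : HeightOneSpectrum (𝓞 ↥(maximalRealSubfield L)))
    (w : PlacesOver L v) (hw : IsCMField.complexConj L • w.1 = w.1)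
    [MeasurableSpace ((cmDatum L 2 (Matrix.of fun i j : Fin 2 => if i.val + j.val + 1 = 2 then (1 : L) else 0)).Local v × (cmDatum L 1 (Matrix.of fun i j : Fin 1 => if i.val + j.val + 1 = 1 then (1 : L) else 0)).Local v)] [BorelSpace ((cmDatum L 2 (Matrix.of fun i j : Fin 2 => if i.val + j.val + 1 = 2 then (1 : L) else 0)).Local v × (cmDatum L 1 (Matrix.of fun i j : Fin 1 => if i.val + j.val + 1 = 1 then (1 : L) else 0)).Local v)]
    [∀ a : ((cmDatum L 2 (Matrix.of fun i j : Fin 2 => if i.val + j.val + 1 = 2 then (1 : L) else 0)).Local v × (cmDatum L 1 (Matrix.of fun i j : Fin 1 => if i.val + j.val + 1 = 1 then (1 : L) else 0)).Local v), MeasurableSpace (((cmDatum L 2 (Matrix.of fun i j : Fin 2 => if i.val + j.val + 1 = 2 then (1 : L) else 0)).Local v × (cmDatum L 1 (Matrix.of fun i j : Fin 1 => if i.val + j.val + 1 = 1 then (1 : L) else 0)).Local v) ⧸ Subgroup.centralizer ({a} : Set ((cmDatum L 2 (Matrix.of fun i j : Fin 2 => if i.val + j.val + 1 = 2 then (1 :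 L) else 0)).Local v × (cmDatum L 1 (Matrix.of fun i j : Fin 1 => if i.val + j.val + 1 = 1 then (1 : L) else 0)).Local v)))]
    [∀ a : ((cmDatum L 2 (Matrix.of fun i j : Fin 2 => if i.val + j.val + 1 = 2 then (1 : L) else 0)).Local v × (cmDatum L 1 (Matrix.of fun i j : Fin 1 => if i.val + j.val + 1 = 1 then (1 : L) else 0)).Local v), BorelSpace (((cmDatum L 2 (Matrix.of fun i j : Fin 2 => if i.val + j.val + 1 = 2 then (1 : L) else 0)).Local v × (cmDatum L 1 (Matrix.of fun i j : Fin 1 => if i.val + j.val + 1 = 1 then (1 : L) else 0)).Local v) ⧸ Subgroup.centralizer ({a} : Set ((cmDatum L 2 (Matrix.of fun i j : Fin 2 => if i.val + j.val + 1 = 2 then (1 : L) else 0)).Local v × (cmDatum L 1 (Matrix.of fun i j : Fin 1 => if i.val + j.val + 1 = 1 then (1 : L) else 0)).Local v)))]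
    (νH : Measure ((cmDatum L 2 (Matrix.of fun i j : Fin 2 => if i.val + j.val + 1 = 2 then (1 : L) else 0)).Local v × (cmDatum L 1 (Matrix.of fun i j : Fin 1 => if i.val + j.val + 1 = 1 then (1 : L) else 0)).Local v)) [νH.IsHaarMeasure] [νH.IsMulRightInvariant]
    {P_H : ((cmDatum L 2 (Matrix.of fun i j : Fin 2 => if i.val + j.val + 1 = 2 then (1 : L) else 0)).Local v × (cmDatum L 1 (Matrix.of fun i j : Fin 1 => if i.val + j.val + 1 = 1 then (1 : L) else 0)).Local v) → Prop} {mH : OrbitalMeasureFamily ((cmDatum L 2 (Matrix.of fun i j : Fin 2 => if i.val + j.val + 1 = 2 then (1 : L) else 0)).Local v × (cmDatum L 1 (Matrix.of fun i j : Fin 1 => if i.val + j.val + 1 = 1 then (1 : L) else 0)).Local v)} (hmH : mH.IsCanonical P_H νH)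
    (hv : Algebra.IsUnramifiedIn (𝓞 L) v.asIdeal)
    (γH : ((cmDatum L 2 (Matrix.of fun i j : Fin 2 => if i.val + j.val + 1 = 2 then (1 : L) else 0)).Local v × (cmDatum L 1 (Matrix.of fun i j : Fin 1 => if i.val + j.val + 1 = 1 then (1 : L) else 0)).Local v)) {d : Fin 2 → (LocalRing L v)ˣ}
    (hd : glDiagonal 2 (LocalRing L v) d = (γH.1.val : GL (Fin 2) (LocalRing L v)))
    (hb : IsUnit ((((d 0)⁻¹ * d 1 : (LocalRing L v)ˣ) : LocalRing L v) - 1))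
    (hreg₂ : IsRegularElt (γH.1.val : GL (Fin 2) (LocalRing L v)))
    (ht1 : ∀ i : Fin 2, Valued.v ((((d i : (LocalRing L v)ˣ) : LocalRing L v) w) - 1) < 1)
    (hPH : P_H (Quotient.out (ConjClasses.mk γH)))
    (hK₁ : ∀ x : (cmDatum L 1 (Matrix.of fun i j : Fin 1 => if i.val + j.val + 1 = 1 then (1 : L) else 0)).Local v, x ∈ cmLocalIntegralLevel L 1 (Matrix.of fun i j : Fin 1 => if i.val + j.val + 1 = 1 then (1 : L) else 0) v) :
    classOrbitalIntegral mH (((((cmLocalIntegralLevel L 2 (Matrix.of fun i j : Fin 2 => if i.val + j.val + 1 = 2 then (1 : L) else 0) v).prod (cmLocalIntegralLevel L 1 (Matrix.of fun i j : Fin 1 => if i.val + j.val + 1 = 1 then (1 : L) else 0) v)) : Subgroup ((cmDatum L 2 (Matrix.of fun i j : Fin 2 => if i.val + j.val + 1 = 2 then (1 : L) else 0)).Local v × (cmDatum L 1 (Matrix.of fun i j : Fin 1 => if i.val + j.val + 1 = 1 then (1 : L) else 0)).Local v)) : Set ((cmDatum L 2 (Matrix.of fun i j : Fin 2 => if i.val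 + j.val + 1 = 2 then (1 : L) else 0)).Local v × (cmDatum L 1 (Matrix.of fun i j : Fin 1 => if i.val + j.val + 1 = 1 then (1 : L) else 0)).Local v)).indicator fun h => if (redMat ((((h).1.val : GL (Fin 2) (UnitaryGroup.LocalRing L v)).val.map (Pi.evalRingHom (fun w' : PlacesOver L v => w'.1.adicCompletion L) w))) - 1) ^ 2 = 0 ∧ (redMat ((((h).1.val : GL (Fin 2) (UnitaryGroup.LocalRing L v)).val.map (Pi.evalRingHom (fun w' : PlacesOver L v => w'.1.adicCompletion L) w))) - 1).rank = 1 then (1 : ℂ) else 0)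
        (ConjClasses.mk γH) =
      (νH.real ((((cmLocalIntegralLevel L 2 (Matrix.of fun i j : Fin 2 => if i.val + j.val + 1 = 2 then (1 : L) else 0) v).prod (cmLocalIntegralLevel L 1 (Matrix.of fun i j : Fin 1 => if i.val + j.val + 1 = 1 then (1 : L) else 0) v)) : Subgroup ((cmDatum L 2 (Matrix.of fun i j : Fin 2 => if i.val + j.val + 1 = 2 then (1 : L) else 0)).Local v × (cmDatum L 1 (Matrix.of fun i j : Fin 1 => if i.val + j.val + 1 = 1 then (1 : L) else 0)).Local v)) : Set ((cmDatum L 2 (Matrix.of fun i j : Fin 2 => if i.val + j.val + 1 = 2 then (1 : L) else 0)).Local v × (cmDatum L 1 (Matrix.of fun i j : Fin 1 => if i.val + j.val + 1 = 1 then (1 : L) else 0)).Local v)) : ℂ) *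
        ((((letI : MeasurableSpace (LocalRing L v) := borel _; haveI : BorelSpace (LocalRing L v) := ⟨rfl⟩
          haveI : SecondCountableTopology (LocalRing L v) := secondCountableTopology_localRing (E := L) v
          ((HeisRing.skewModulus (conjLocal L (IsCMField.complexConj L) v) (continuous_conjLocal L (IsCMField.complexConj L) v) hb.unit
            (LineRing.map_unit_torusScalar_sub_one_two (conjLocal L (IsCMField.complexConj L) v) (cmLocalForm_eq_over L 2 v)
              (⟨(γH).1, ⟨d, hd⟩⟩ : ↥(torusU (conjLocal L (IsCMField.complexConj L) v) (cmLocalForm L 2 v))) hd hb))⁻¹ : ℝ≥0)) : ℝ≥0) : ℝ) : ℂ) *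
        (((Ideal.absNorm v.asIdeal : ℂ))⁻¹ * ((Ideal.absNorm v.asIdeal : ℂ) - 1)) :=
  classOrbitalIntegral_chiOne_eq_of_torus_deep L v w hw νH hmH hv ⟨γH.1, ⟨d, hd⟩⟩ hd hb hreg₂ ht1 γH.2 hPH hK₁ _

end HSide

/-! ## §3 THE CLAUSE — the text of `stub_T3prime_levi` (END fold v1-le1 82802cfb :177–:242) VERBATIM -/

section Main

set_option maxHeartbeats 1600000 in
-- instance-term unification on the CM local carriers (pattern of ★ FILE D ∕ ★ S0 FILE 2)
/-- **T3′ HEAD v4, CLAUSE (P-3) LEVI** (architect A-67 (3)): the same for deep `G`-regular `γH` that are `H_v`-conjugate to a diagonal (split-torus) element (non-compact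
centraliser; the Levi-clause sockets ★ `UnitFundamentalLemmaInertLeviClause` ∕ `UnitOrbitalIntegralSplitTorusHSide` generalised to strata-constant pieces; second wave).
Statement-first (by `sorry`). [cite: Rogawski1990, §4.9 Prop. 4.9.1 (a) p. 55; §8.1 Prop. 8.1.1 p. 112] [cite: LanglandsShelstad1987, §1.3–1.4] -/
theorem depthZeroKappaTransfer_hyperspecial_levi
    (L : Type) [Field L] [NumberField L] [IsCMField L] (H' : Matrix (Fin 3) (Fin 3) L) (μ : HeckeCharacter L)
    {v : HeightOneSpectrum (𝓞 ↥(maximalRealSubfield L))}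
    (hH' : (H'.map (cmConjRingHom L)).transpose = H') (w : PlacesOver L v)
    (hw : IsCMField.complexConj L • w.1 = w.1) (hv : Algebra.IsUnramifiedIn (𝓞 L) v.asIdeal)
    (hH'w : IsUnit (placeForm H' w.1)) (hH'i : hH'w.unit ∈ glInt 3 (w.1.adicCompletion L))
    (hμ : μ.IsUnramifiedAt w.1) (hμu : μ.IsUnitary)
    (hμω : ∀ x : ideleGroup ↥(maximalRealSubfield L), μ (AdeleRing.ideleBaseChange ↥(maximalRealSubfield L) L x) = quadraticHeckeCharCM L x)
    (h2 : IsUnit (2 : 𝒪[w.1.adicCompletion L]))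
    [MeasurableSpace ((cmDatum L 3 H').Local v)] [BorelSpace ((cmDatum L 3 H').Local v)]
    [∀ γ : ((cmDatum L 3 H').Local v), MeasurableSpace (((cmDatum L 3 H').Local v) ⧸ Subgroup.centralizer ({γ} : Set ((cmDatum L 3 H').Local v)))]
    [∀ γ : ((cmDatum L 3 H').Local v), BorelSpace (((cmDatum L 3 H').Local v) ⧸ Subgroup.centralizer ({γ} : Set ((cmDatum L 3 H').Local v)))]
    [MeasurableSpace ((cmDatum L 2 (Matrix.of fun i j : Fin 2 => if i.val + j.val + 1 = 2 then (1 : L) else 0)).Local v ×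
      (cmDatum L 1 (Matrix.of fun i j : Fin 1 => if i.val + j.val + 1 = 1 then (1 : L) else 0)).Local v)]
    [BorelSpace ((cmDatum L 2 (Matrix.of fun i j : Fin 2 => if i.val + j.val + 1 = 2 then (1 : L) else 0)).Local v ×
      (cmDatum L 1 (Matrix.of fun i j : Fin 1 => if i.val + j.val + 1 = 1 then (1 : L) else 0)).Local v)]
    [∀ a : ((cmDatum L 2 (Matrix.of fun i j : Fin 2 => if i.val + j.val + 1 = 2 then (1 : L) else 0)).Local v ×
      (cmDatum L 1 (Matrix.of fun i j : Fin 1 => if i.val + j.val + 1 = 1 then (1 : L) else 0)).Local v),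
      MeasurableSpace (((cmDatum L 2 (Matrix.of fun i j : Fin 2 => if i.val + j.val + 1 = 2 then (1 : L) else 0)).Local v ×
      (cmDatum L 1 (Matrix.of fun i j : Fin 1 => if i.val + j.val + 1 = 1 then (1 : L) else 0)).Local v) ⧸ Subgroup.centralizer ({a} : Set ((cmDatum L 2 (Matrix.of fun i j : Fin 2 => if i.val + j.val + 1 = 2 then (1 : L) else 0)).Local v ×
      (cmDatum L 1 (Matrix.of fun i j : Fin 1 => if i.val + j.val + 1 = 1 then (1 : L) else 0)).Local v)))]
    [∀ a : ((cmDatum L 2 (Matrix.of fun i j : Fin 2 => if i.val + j.val + 1 = 2 then (1 : L) else 0)).Local v ×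
      (cmDatum L 1 (Matrix.of fun i j : Fin 1 => if i.val + j.val + 1 = 1 then (1 : L) else 0)).Local v),
      BorelSpace (((cmDatum L 2 (Matrix.of fun i j : Fin 2 => if i.val + j.val + 1 = 2 then (1 : L) else 0)).Local v ×
      (cmDatum L 1 (Matrix.of fun i j : Fin 1 => if i.val + j.val + 1 = 1 then (1 : L) else 0)).Local v) ⧸ Subgroup.centralizer ({a} : Set ((cmDatum L 2 (Matrix.of fun i j : Fin 2 => if i.val + j.val + 1 = 2 then (1 : L) else 0)).Local v ×
      (cmDatum L 1 (Matrix.of fun i j : Fin 1 => if i.val + j.val + 1 = 1 then (1 : L) else 0)).Local v)))]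
    (νH : Measure ((cmDatum L 2 (Matrix.of fun i j : Fin 2 => if i.val + j.val + 1 = 2 then (1 : L) else 0)).Local v ×
      (cmDatum L 1 (Matrix.of fun i j : Fin 1 => if i.val + j.val + 1 = 1 then (1 : L) else 0)).Local v)) [νH.IsHaarMeasure] [νH.IsMulRightInvariant]
    (νG : Measure ((cmDatum L 3 H').Local v)) [νG.IsHaarMeasure] [νG.IsMulRightInvariant]
    {mH : OrbitalMeasureFamily ((cmDatum L 2 (Matrix.of fun i j : Fin 2 => if i.val + j.val + 1 = 2 then (1 : L) else 0)).Local v ×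
      (cmDatum L 1 (Matrix.of fun i j : Fin 1 => if i.val + j.val + 1 = 1 then (1 : L) else 0)).Local v)} {mG : OrbitalMeasureFamily ((cmDatum L 3 H').Local v)}
    (hmH : mH.IsCanonical (IsLocalGRegular L v) νH)
    (hmG : mG.IsCanonical (fun γ => IsRegularElt (γ.val : GL (Fin 3) (UnitaryGroup.LocalRing L v))) νG)
    -- the depth-zero piece at the hyperspecial vertex: `C_c^∞`, supported in `K`, constant on the residually-unipotent Jordan strata of `K`
    (g : ((cmDatum L 3 H').Local v) → ℂ) (hg : IsLocSmooth g) (hgK : tsupport g ⊆ (cmLocalIntegralLevel L 3 H' v : Set ((cmDatum L 3 H').Local v)))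
    (hginv : ∀ u ∈ cmLocalIntegralLevel L 3 H' v, ∀ x, g (u * x * u⁻¹) = g x)
    (c : ℕ → ℂ)
    (hc : ∀ k ∈ cmLocalIntegralLevel L 3 H' v,
      (redMat (((k.val : GL (Fin 3) (UnitaryGroup.LocalRing L v)).val.map (Pi.evalRingHom (fun w' : PlacesOver L v => w'.1.adicCompletion L) w))) - 1) ^ 3 = 0 →
      g k = c (redMat (((k.val : GL (Fin 3) (UnitaryGroup.LocalRing L v)).val.map (Pi.evalRingHom (fun w' : PlacesOver L v => w'.1.adicCompletion L) w))) - 1).rank) :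
    ∃ V ∈ 𝓝 (1 : ((cmDatum L 2 (Matrix.of fun i j : Fin 2 => if i.val + j.val + 1 = 2 then (1 : L) else 0)).Local v ×
        (cmDatum L 1 (Matrix.of fun i j : Fin 1 => if i.val + j.val + 1 = 1 then (1 : L) else 0)).Local v)),
      ∀ γH ∈ V, IsLocalGRegular L v γH →
        (∃ (y : ((cmDatum L 2 (Matrix.of fun i j : Fin 2 => if i.val + j.val + 1 = 2 then (1 : L) else 0)).Local v ×
        (cmDatum L 1 (Matrix.of fun i j : Fin 1 => if i.val + j.val + 1 = 1 then (1 : L) else 0)).Local v)) (d' : Fin 2 → (UnitaryGroup.LocalRing L v)ˣ),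
          glDiagonal 2 (UnitaryGroup.LocalRing L v) d' = ((y * γH * y⁻¹).1.val : GL (Fin 2) (UnitaryGroup.LocalRing L v))) →
        ∑ᶠ cG : ConjClasses ((cmDatum L 3 H').Local v),
            ((finExplicitCollection L H' μ (finExplicitDelta_conj_left_all L H' μ) (finExplicitDelta_conj_right_all L H' μ)) v).Δ γH (Quotient.out cG) *
              classOrbitalIntegral mG g cG =
          -- `a₀ · Φ^st(γH, χ₀)`, `a₀ = (ν_G(K)∕ν_H(K_H)) · (q⁻² c 0 + ((q²−1)∕q²) c 1)`, `χ₀ = 1_{{h ∈ K_H : h̄_W = 1}}`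
          ((νG.real (cmLocalIntegralLevel L 3 H' v : Set ((cmDatum L 3 H').Local v)) / νH.real (((cmLocalIntegralLevel L 2 (Matrix.of fun i j : Fin 2 => if i.val + j.val + 1 = 2 then (1 : L) else 0) v).prod
                (cmLocalIntegralLevel L 1 (Matrix.of fun i j : Fin 1 => if i.val + j.val + 1 = 1 then (1 : L) else 0) v) : Subgroup _) : Set _) : ℝ) : ℂ) * (((Ideal.absNorm v.asIdeal : ℂ) ^ 2)⁻¹ * c 0 + (((Ideal.absNorm v.asIdeal : ℂ) ^ 2 - 1) / (Ideal.absNorm v.asIdeal : ℂ) ^ 2) * c 1) *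
              stableOrbitalIntegralRel (IsLocalStablyConjH L v) mH
                ((((cmLocalIntegralLevel L 2 (Matrix.of fun i j : Fin 2 => if i.val + j.val + 1 = 2 then (1 : L) else 0) v).prod
                (cmLocalIntegralLevel L 1 (Matrix.of fun i j : Fin 1 => if i.val + j.val + 1 = 1 then (1 : L) else 0) v) : Subgroup _) : Set _).indicator
              (fun h => if (redMat (((h.1.val : GL (Fin 2) (UnitaryGroup.LocalRing L v)).val.map (Pi.evalRingHom (fun w' : PlacesOver L v => w'.1.adicCompletion L) w))) - 1) ^ 2 = 0 ∧ (redMat (((h.1.val : GL (Fin 2) (UnitaryGroup.LocalRing L v)).val.map (Pi.evalRingHom (fun w' : PlacesOver L v => w'.1.adicCompletion L) w))) - 1).rank = 0 then (1 : ℂ) else 0)) γH +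
          -- `a₁ · Φ^st(γH, χ₁)`, `a₁ = (ν_G(K)∕ν_H(K_H)) · (−q⁻¹ c 1 + ((q+1)∕q) c 2)`, `χ₁ = 1_{{h ∈ K_H : h̄_W unipotent, rank(h̄_W − 1) = 1}}`
          ((νG.real (cmLocalIntegralLevel L 3 H' v : Set ((cmDatum L 3 H').Local v)) / νH.real (((cmLocalIntegralLevel L 2 (Matrix.of fun i j : Fin 2 => if i.val + j.val + 1 = 2 then (1 : L) else 0) v).prod
                (cmLocalIntegralLevel L 1 (Matrix.of fun i j : Fin 1 => if i.val + j.val + 1 = 1 then (1 : L) else 0) v) : Subgroup _) : Set _) : ℝ) : ℂ) * (-((Ideal.absNorm v.asIdeal : ℂ))⁻¹ * c 1 + (((Ideal.absNorm v.asIdeal : ℂ) + 1) / (Ideal.absNorm v.asIdeal : ℂ)) * c 2) *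
              stableOrbitalIntegralRel (IsLocalStablyConjH L v) mH
                ((((cmLocalIntegralLevel L 2 (Matrix.of fun i j : Fin 2 => if i.val + j.val + 1 = 2 then (1 : L) else 0) v).prod
                (cmLocalIntegralLevel L 1 (Matrix.of fun i j : Fin 1 => if i.val + j.val + 1 = 1 then (1 : L) else 0) v) : Subgroup _) : Set _).indicator
              (fun h => if (redMat (((h.1.val : GL (Fin 2) (UnitaryGroup.LocalRing L v)).val.map (Pi.evalRingHom (fun w' : PlacesOver L v => w'.1.adicCompletion L) w))) - 1) ^ 2 = 0 ∧ (redMat (((h.1.val : GL (Fin 2) (UnitaryGroup.LocalRing L v)).val.map (Pi.evalRingHom (fun w' : PlacesOver L v => w'.1.adicCompletion L) w))) - 1).rank = 1 then (1 : ℂ) else 0)) γH := by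
  have _hμu := hμu  -- idle binder of the registered text (the clause does not use unitarity of `μ`)
  have hcne := IsCMField.complexConj_ne_one L
  haveI : Algebra.IsQuadraticExtension ↥(maximalRealSubfield L) L := IsCMField.isQuadraticExtension L
  have hvs : Subsingleton (PlacesOver L v) := PlacesOver.subsingleton_of_smul_eq (IsCMField.complexConj L) hcne w hw
  -- dialect bridges: `ᵗ(H̄′) = H′` in the `IsCMField.complexConj` spelling, `det H′ ≠ 0` from `hH′w`, `|2|_w = 1` from `h2`
  have hH'c : (H'.map (IsCMField.complexConj L))ᵀ = H' := by
    have e : H'.map (cmConjRingHom L) = H'.map (IsCMField.complexConj L) := by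
      ext i j; simp [Matrix.map_apply, cmConjRingHom_apply]
    rw [← e]; exact hH'
  have hH'd : IsUnit H'.det := by
    have h1 := (Matrix.isUnit_iff_isUnit_det _).1 hH'w
    rw [show (UnitaryGroup.placeForm H' w.1).det = algebraMap L (w.1.adicCompletion L) H'.det from (RingHom.map_det _ _).symm] at h1
    exact isUnit_iff_ne_zero.2 fun h0 => isUnit_iff_ne_zero.1 h1 (by rw [h0, map_zero])
  -- (O1) the neighbourhood of `1 ∈ H_v`
  have hO1 := exists_nhds_one_forall_levi_deep L v w
  obtain ⟨V, hV, hdeep⟩ := hO1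
  refine ⟨V, hV, fun γH hγV hreg hlevi => ?_⟩
  obtain ⟨y, d', hyd'⟩ := hlevi
  -- the Levi representative `γ₁ := y γ_H y⁻¹`
  have hconj : IsConj γH (y * γH * y⁻¹) := isConj_iff.2 ⟨y, rfl⟩
  have hst : IsLocalStablyConjH L v γH (y * γH * y⁻¹) := (isLocalStablyConjH_of_isConj_and_conj L γH).1 _ hconj
  have hreg₁ : IsLocalGRegular L v (y * γH * y⁻¹) := (isLocalGRegular_conj_iff L y γH).2 hreg
  -- (T) transport of the three terms from `γ_H` to `γ₁` (both sides are stable class functions)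
  have hiff : ∀ ε, IsLocalStablyConjH L v γH ε ↔ IsLocalStablyConjH L v (y * γH * y⁻¹) ε :=
    fun ε => ⟨fun hε => IsStablyConjH.trans (IsStablyConjH.symm hst) hε, fun hε => IsStablyConjH.trans hst hε⟩
  rw [stableOrbitalIntegralRel_congr (st := IsLocalStablyConjH L v) hiff mH, stableOrbitalIntegralRel_congr (st := IsLocalStablyConjH L v) hiff mH]
  rw [show (fun cG : ConjClasses ((cmDatum L 3 H').Local v) =>
      ((finExplicitCollection L H' μ (finExplicitDelta_conj_left_all L H' μ) (finExplicitDelta_conj_right_all L H' μ)) v).Δ γH (Quotient.out cG) *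
        classOrbitalIntegral mG g cG) =
      fun cG => ((finExplicitCollection L H' μ (finExplicitDelta_conj_left_all L H' μ) (finExplicitDelta_conj_right_all L H' μ)) v).Δ
        (y * γH * y⁻¹) (Quotient.out cG) * classOrbitalIntegral mG g cG from
    funext fun cG => by rw [finExplicitCollection_Δ_eq_of_isLocalStablyConjH L v H' μ _ _ hst (Quotient.out cG)]]
  -- Levi data at `γ₁`: `ι(γ₁) = diag(d′₀, u, d′₁)`, the three units, deepness
  obtain ⟨ha, hb, h12⟩ := isUnit_levi_of_isLocalGRegular_of_nonsplit L w hw hyd' hreg₁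
  have hι := endoEmbLocal_eq_glDiagonal_of_fst_eq L v (y * γH * y⁻¹) hyd'
  have hu : (((isUnit_finGammaTwo L v (y * γH * y⁻¹)).unit : (UnitaryGroup.LocalRing L v)ˣ) : UnitaryGroup.LocalRing L v) =
      finGammaTwo L v (y * γH * y⁻¹) := (isUnit_finGammaTwo L v (y * γH * y⁻¹)).unit_spec
  have hreg3 := isUnit_vecCons_sub_of_levi ha hb (by rw [hu]; exact h12)
  have h01 : IsUnit ((d' 0 : UnitaryGroup.LocalRing L v) - d' 1) := by simpa using hreg3 0 2 (by decide)
  have hHC := isLocalStablyConjH_of_isConj_and_conj L (y * γH * y⁻¹)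
  -- (R) each right-side stable integral is ONE orbital integral (the `H`-stable class of `γ₁` is one class) …
  have hS0 : stableOrbitalIntegralRel (IsLocalStablyConjH L v) mH
      (((((cmLocalIntegralLevel L 2 (Matrix.of fun i j : Fin 2 => if i.val + j.val + 1 = 2 then (1 : L) else 0) v).prod (cmLocalIntegralLevel L 1 (Matrix.of fun i j : Fin 1 => if i.val + j.val + 1 = 1 then (1 : L) else 0) v)) : Subgroup ((cmDatum L 2 (Matrix.of fun i j : Fin 2 => if i.val + j.val + 1 = 2 then (1 : L) else 0)).Local v × (cmDatum L 1 (Matrix.of fun i j : Fin 1 => if i.val + j.val + 1 = 1 then (1 : L) else 0)).Local v)) : Set ((cmDatum L 2 (Matrix.of fun i j : Fin 2 => if i.val + j.val + 1 = 2 then (1 : L) else 0)).Local v × (cmDatum L 1 (Matrix.of fun i j : Fin 1 => if i.val + j.val + 1 = 1 then (1 : L) else 0)).Local v)).indicator fun h => if (redMat ((((h).1.val : GL (Fin 2) (UnitaryGroup.LocalRing L v)).val.map (Pi.evalRingHom (fun w' : PlacesOver L v => w'.1.adicCompletion L) w))) - 1) ^ 2 = 0 ∧ (redMat ((((h).1.val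 : GL (Fin 2) (UnitaryGroup.LocalRing L v)).val.map (Pi.evalRingHom (fun w' : PlacesOver L v => w'.1.adicCompletion L) w))) - 1).rank = 0 then (1 : ℂ) else 0) (y * γH * y⁻¹) =
      classOrbitalIntegral mH (((((cmLocalIntegralLevel L 2 (Matrix.of fun i j : Fin 2 => if i.val + j.val + 1 = 2 then (1 : L) else 0) v).prod (cmLocalIntegralLevel L 1 (Matrix.of fun i j : Fin 1 => if i.val + j.val + 1 = 1 then (1 : L) else 0) v)) : Subgroup ((cmDatum L 2 (Matrix.of fun i j : Fin 2 => if i.val + j.val + 1 = 2 then (1 : L) else 0)).Local v × (cmDatum L 1 (Matrix.of fun i j : Fin 1 => if i.val + j.val + 1 = 1 then (1 : L) else 0)).Local v)) : Set ((cmDatum L 2 (Matrix.of fun i j : Fin 2 => if i.val + j.val + 1 = 2 then (1 : L) else 0)).Local v × (cmDatum L 1 (Matrix.of fun i j : Fin 1 => if i.val + j.val + 1 = 1 then (1 : L) else 0)).Local v)).indicator fun h => if (redMat ((((h).1.val : GL (Fin 2) (UnitaryGroup.LocalRing L v)).val.map (Pi.evalRingHom (fun w' : PlacesOver L v => w'.1.adicCompletion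 L) w))) - 1) ^ 2 = 0 ∧ (redMat ((((h).1.val : GL (Fin 2) (UnitaryGroup.LocalRing L v)).val.map (Pi.evalRingHom (fun w' : PlacesOver L v => w'.1.adicCompletion L) w))) - 1).rank = 0 then (1 : ℂ) else 0) (ConjClasses.mk (y * γH * y⁻¹)) :=
    stableOrbitalIntegralRel_eq_classOrbitalIntegral_of_unique (IsLocalStablyConjH L v) mH _ (y * γH * y⁻¹) hHC.1
      (fun k hk => isConj_of_isLocalStablyConjH_of_levi L hyd' h01 hk)
  have hS1 : stableOrbitalIntegralRel (IsLocalStablyConjH L v) mH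
      (((((cmLocalIntegralLevel L 2 (Matrix.of fun i j : Fin 2 => if i.val + j.val + 1 = 2 then (1 : L) else 0) v).prod (cmLocalIntegralLevel L 1 (Matrix.of fun i j : Fin 1 => if i.val + j.val + 1 = 1 then (1 : L) else 0) v)) : Subgroup ((cmDatum L 2 (Matrix.of fun i j : Fin 2 => if i.val + j.val + 1 = 2 then (1 : L) else 0)).Local v × (cmDatum L 1 (Matrix.of fun i j : Fin 1 => if i.val + j.val + 1 = 1 then (1 : L) else 0)).Local v)) : Set ((cmDatum L 2 (Matrix.of fun i j : Fin 2 => if i.val + j.val + 1 = 2 then (1 : L) else 0)).Local v × (cmDatum L 1 (Matrix.of fun i j : Fin 1 => if i.val + j.val + 1 = 1 then (1 : L) else 0)).Local v)).indicator fun h => if (redMat ((((h).1.val : GL (Fin 2) (UnitaryGroup.LocalRing L v)).val.map (Pi.evalRingHom (fun w' : PlacesOver L v => w'.1.adicCompletion L) w))) - 1) ^ 2 = 0 ∧ (redMat ((((h).1.val : GL (Fin 2) (UnitaryGroup.LocalRing L v)).val.map (Pi.evalRingHom (fun w' : PlacesOver L v => w'.1.adicCompletion L) w))) - 1).rank = 1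 then (1 : ℂ) else 0) (y * γH * y⁻¹) =
      classOrbitalIntegral mH (((((cmLocalIntegralLevel L 2 (Matrix.of fun i j : Fin 2 => if i.val + j.val + 1 = 2 then (1 : L) else 0) v).prod (cmLocalIntegralLevel L 1 (Matrix.of fun i j : Fin 1 => if i.val + j.val + 1 = 1 then (1 : L) else 0) v)) : Subgroup ((cmDatum L 2 (Matrix.of fun i j : Fin 2 => if i.val + j.val + 1 = 2 then (1 : L) else 0)).Local v × (cmDatum L 1 (Matrix.of fun i j : Fin 1 => if i.val + j.val + 1 = 1 then (1 : L) else 0)).Local v)) : Set ((cmDatum L 2 (Matrix.of fun i j : Fin 2 => if i.val + j.val + 1 = 2 then (1 : L) else 0)).Local v × (cmDatum L 1 (Matrix.of fun i j : Fin 1 => if i.val + j.val + 1 = 1 then (1 : L) else 0)).Local v)).indicator fun h => if (redMat ((((h).1.val : GL (Fin 2) (UnitaryGroup.LocalRing L v)).val.map (Pi.evalRingHom (fun w' : PlacesOver L v => w'.1.adicCompletion L) w))) - 1) ^ 2 = 0 ∧ (redMat ((((h).1.val : GL (Fin 2) (UnitaryGroup.LocalRing L v)).val.map (Pi.evalRingHom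 (fun w' : PlacesOver L v => w'.1.adicCompletion L) w))) - 1).rank = 1 then (1 : ℂ) else 0) (ConjClasses.mk (y * γH * y⁻¹)) :=
    stableOrbitalIntegralRel_eq_classOrbitalIntegral_of_unique (IsLocalStablyConjH L v) mH _ (y * γH * y⁻¹) hHC.1
      (fun k hk => isConj_of_isLocalStablyConjH_of_levi L hyd' h01 hk)
  have ht1₃ : ∀ i : Fin 3, Valued.v ((((![d' 0, (isUnit_finGammaTwo L v (y * γH * y⁻¹)).unit, d' 1] i : (UnitaryGroup.LocalRing L v)ˣ) :
      UnitaryGroup.LocalRing L v) w) - 1) < 1 := hdeep γH hγV y _ hι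
  have ht1 : ∀ i : Fin 2, Valued.v ((((d' i : (UnitaryGroup.LocalRing L v)ˣ) : UnitaryGroup.LocalRing L v) w) - 1) < 1 := by
    intro i
    fin_cases i
    · simpa using ht1₃ 0
    · simpa using ht1₃ 2
  -- `γ₁ ∈ K_H` (deep torus entries are units; `K₁ = U(Φ₁)(L⁺_v)`), hence `ι(γ₁) ∈ K₃`
  have hK₁ : ∀ x : (cmDatum L 1 (Matrix.of fun i j : Fin 1 => if i.val + j.val + 1 = 1 then (1 : L) else 0)).Local v,
      x ∈ cmLocalIntegralLevel L 1 (Matrix.of fun i j : Fin 1 => if i.val + j.val + 1 = 1 then (1 : L) else 0) v := fun x => by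
    rw [cmLocalIntegralLevel_one_eq_top_of_smul_eq L _ w hw (isUnit_placeForm_antidiagOne (E := L) 1 w.1)]; exact Subgroup.mem_top x
  have hint₁ : ∀ i : ℕ, ((((endoEmbLocal L v (y * γH * y⁻¹)).val : GL (Fin 3) (UnitaryGroup.LocalRing L v)).val.map
      (Pi.evalRingHom (fun w' : PlacesOver L v => w'.1.adicCompletion L) w)).charpoly.coeff i) ∈ Valued.integer (w.1.adicCompletion L) := by
    intro i
    rw [hι, coe_glDiagonal, Matrix.diagonal_map (map_zero _), Matrix.charpoly_diagonal]
    -- a product of monic linear integral factors has integral coefficients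
    have hint : ∀ k : Fin 3, ((![d' 0, (isUnit_finGammaTwo L v (y * γH * y⁻¹)).unit, d' 1] k : (UnitaryGroup.LocalRing L v)ˣ) :
        UnitaryGroup.LocalRing L v) w ∈ Valued.integer (w.1.adicCompletion L) := by
      intro k
      rw [Valued.integer, Valuation.mem_integer_iff]
      have hk := ht1₃ k
      have : Valued.v ((((![d' 0, (isUnit_finGammaTwo L v (y * γH * y⁻¹)).unit, d' 1] k : (UnitaryGroup.LocalRing L v)ˣ) :
          UnitaryGroup.LocalRing L v) w)) = Valued.v ((((![d' 0, (isUnit_finGammaTwo L v (y * γH * y⁻¹)).unit, d' 1] k :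
          (UnitaryGroup.LocalRing L v)ˣ) : UnitaryGroup.LocalRing L v) w - 1) + 1) := by rw [sub_add_cancel]
      rw [this]
      exact le_trans (Valued.v.map_add _ _) (max_le hk.le (by rw [Valued.v.map_one]))
    have hpoly : (∏ k : Fin 3, (Polynomial.X - Polynomial.C ((Pi.evalRingHom (fun w' : PlacesOver L v => w'.1.adicCompletion L) w)
        (((![d' 0, (isUnit_finGammaTwo L v (y * γH * y⁻¹)).unit, d' 1] k : (UnitaryGroup.LocalRing L v)ˣ) : UnitaryGroup.LocalRing L v))))) =
        (∏ k : Fin 3, (Polynomial.X - Polynomial.C (⟨_, hint k⟩ : ↥(Valued.integer (w.1.adicCompletion L))))).map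
          (Valued.integer (w.1.adicCompletion L)).subtype := by
      rw [Polynomial.map_prod]
      refine Finset.prod_congr rfl fun k _ => ?_
      rw [Polynomial.map_sub, Polynomial.map_X, Polynomial.map_C]
      rfl
    rw [hpoly, Polynomial.coeff_map]
    exact Subtype.coe_prop _
  have hγ₁K := mem_prod_cmLocalIntegralLevel_of_levi_of_integral_charpoly L w hw hyd' hint₁
  have hint := endoEmbLocal_mem_cmLocalIntegralLevel_of_nonsplit L w hw hγ₁K
  -- the level-preserving Jacobowitz frame `ψ : G′_v ≃ U(Φ₃)(L⁺_v)`, the torus element `t = ι(γ₁) ∈ T ∩ K₃` and the match `γ₀ := ψ⁻¹(t)`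
  have hfr := exists_continuousMulEquiv_level_formCongr_of_nonsplit L H' hH'c w hw hv hH'w hH'i
  obtain ⟨ψ, T, hT, -, hlev, hψc, hψw⟩ := hfr
  letI : MeasurableSpace ↥(unitaryGroupOfForm (conjLocal L (IsCMField.complexConj L) v) (cmLocalForm L 3 v)) := borel _
  haveI : BorelSpace ↥(unitaryGroupOfForm (conjLocal L (IsCMField.complexConj L) v) (cmLocalForm L 3 v)) := ⟨rfl⟩
  have htT := endoEmbLocal_mem_torusU_of_endoEmbLocal_eq L v (y * γH * y⁻¹) hι
  have hdT : glDiagonal 3 (UnitaryGroup.LocalRing L v) ![d' 0, (isUnit_finGammaTwo L v (y * γH * y⁻¹)).unit, d' 1] =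
      (((⟨_, htT⟩ : ↥(torusU (conjLocal L (IsCMField.complexConj L) v) (cmLocalForm L 3 v))) :
        ↥(unitaryGroupOfForm (conjLocal L (IsCMField.complexConj L) v) (cmLocalForm L 3 v))) : GL (Fin 3) (UnitaryGroup.LocalRing L v)) := hι.symm
  have hγ₀ : ψ (ψ.symm (endoEmbLocal L v (y * γH * y⁻¹))) =
      (((⟨_, htT⟩ : ↥(torusU (conjLocal L (IsCMField.complexConj L) v) (cmLocalForm L 3 v))) :
        ↥(unitaryGroupOfForm (conjLocal L (IsCMField.complexConj L) v) (cmLocalForm L 3 v)))) := ψ.apply_symm_apply _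
  -- (O2) the `G`-side value at `γ₀`
  have hG := classOrbitalIntegral_eq_mul_rankStrata_of_torus_deep L w hw H' hH'c hH'd hv h2 νG hmG ψ hlev hψc T hT hψw ⟨_, htT⟩ hdT hreg3 ha hb ht1₃ hγ₀
    g hg hgK hginv c hc
  have hconj₀ : IsConj (((⟨_, htT⟩ : ↥(torusU (conjLocal L (IsCMField.complexConj L) v) (cmLocalForm L 3 v))) :
        ↥(unitaryGroupOfForm (conjLocal L (IsCMField.complexConj L) v) (cmLocalForm L 3 v))) : GL (Fin 3) (UnitaryGroup.LocalRing L v))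
      ((ψ.symm (endoEmbLocal L v (y * γH * y⁻¹))).val : GL (Fin 3) (UnitaryGroup.LocalRing L v)) := by
    have h1 := hψc (ψ.symm (endoEmbLocal L v (y * γH * y⁻¹)))
    rw [hγ₀] at h1
    exact h1.symm
  have h₀ : IsLocalNormPair L H' v (y * γH * y⁻¹) (ψ.symm (endoEmbLocal L v (y * γH * y⁻¹))) := hconj₀
  -- … (O3) with the L-δ values at `γ₁ = (diag(d′), u)`, `d′` regular and deep
  have h3 : IsRegularElt ((endoEmbLocal L v (y * γH * y⁻¹)).val : GL (Fin 3) (UnitaryGroup.LocalRing L v)) := hreg₁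
  rw [isRegularElt_iff, coe_endoEmbLocal, charpoly_endoGL] at h3
  have hreg₂ : IsRegularElt ((y * γH * y⁻¹).1.val : GL (Fin 2) (UnitaryGroup.LocalRing L v)) := h3.of_mul_left
  have hPH : IsLocalGRegular L v (Quotient.out (ConjClasses.mk (y * γH * y⁻¹))) := isLocalGRegular_out_mk hreg₁
  have hH0 := classOrbitalIntegral_chiZero_eq_of_levi_deep L v w hw νH hmH hv (y * γH * y⁻¹) hyd' hb hreg₂ ht1 hPH hK₁
  have hH1 := classOrbitalIntegral_chiOne_eq_of_levi_deep L v w hw νH hmH hv (y * γH * y⁻¹) hyd' hb hreg₂ ht1 hPH hK₁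
  refine Eq.trans ?_ (congrArg₂ (fun u u' => _ * u + _ * u') (hS0.trans hH0).symm (hS1.trans hH1).symm)
  -- (L) the left side has ONE term (all matches of `γ₁` are conjugate), with `Δ‴ = ‖a − 1‖` (T5-Levi) and the `G`-side value (O2)
  have hL1 := finsum_delta_mul_classOrbitalIntegral_eq_of_unique
    ((finExplicitCollection L H' μ (finExplicitDelta_conj_left_all L H' μ) (finExplicitDelta_conj_right_all L H' μ)) v) mG g (y * γH * y⁻¹) (ψ.symm (endoEmbLocal L v (y * γH * y⁻¹)))
    (fun k hk => isConj_of_isLocalNormPair_of_isLocalNormPair_of_levi L H' hH'c hH'd (y * γH * y⁻¹) hι hreg3 h₀ hk)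
  refine hL1.trans ?_
  have hΔ := finExplicitDelta_eq_unitModulusChar_of_levi_of_nonsplit L H' hH'c hH'd w hw hv hH'w hH'i μ hμ hμω (y * γH * y⁻¹) hι hreg3 hint ha h₀
  refine (congrArg₂ (· * ·) ((finExplicitCollection_Δ L H' μ (finExplicitDelta_conj_left_all L H' μ) (finExplicitDelta_conj_right_all L H' μ) v
    (y * γH * y⁻¹) (ψ.symm (endoEmbLocal L v (y * γH * y⁻¹)))).trans hΔ) hG).trans ?_
  -- (O4) the prefactor `‖a − 1‖ · J₃(t) = J_H(t₂)` and the final algebra (★ p846176 `depthZero_matrix_identity_levi`, here by `field_simp; ring`)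
  have hpref := levi_prefactor_eq L v ⟨_, htT⟩ hdT ha hb ⟨(y * γH * y⁻¹).1, ⟨d', hyd'⟩⟩ hyd' hb (by simp)
  -- nonvanishing constants
  have hq : (Ideal.absNorm v.asIdeal : ℂ) ≠ 0 := by
    have h0 : Ideal.absNorm v.asIdeal ≠ 0 := by
      rw [Ne, Ideal.absNorm_eq_zero_iff]; exact v.ne_bot
    exact_mod_cast h0
  have hKH : (νH.real ((((cmLocalIntegralLevel L 2 (Matrix.of fun i j : Fin 2 => if i.val + j.val + 1 = 2 then (1 : L) else 0) v).prod (cmLocalIntegralLevel L 1 (Matrix.of fun i j : Fin 1 => if i.val + j.val + 1 = 1 then (1 : L) else 0) v)) : Subgroup ((cmDatum L 2 (Matrix.of fun i j : Fin 2 => if i.val + j.val + 1 = 2 then (1 : L) else 0)).Local v × (cmDatum L 1 (Matrix.of fun i j : Fin 1 => if i.val + j.val + 1 = 1 then (1 : L) else 0)).Local v)) : Set ((cmDatum L 2 (Matrix.of fun i j : Fin 2 => if i.val + j.val + 1 = 2 then (1 : L) else 0)).Local v × (cmDatum L 1 (Matrix.of fun i j : Fin 1 => if i.val + j.val + 1 =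 1 then (1 : L) else 0)).Local v)) : ℂ) ≠ 0 := by
    have hco := isCompact_isOpen_cmLocalIntegralLevel_prod L 2 1 (Matrix.of fun i j : Fin 2 => if i.val + j.val + 1 = 2 then (1 : L) else 0)
      (Matrix.of fun i j : Fin 1 => if i.val + j.val + 1 = 1 then (1 : L) else 0) v
    have hpos := hco.2.measure_pos νH ⟨1, Subgroup.one_mem _⟩
    have hfin := hco.1.measure_lt_top (μ := νH)
    exact_mod_cast (ENNReal.toReal_pos hpos.ne' hfin.ne).ne'
  -- `J_H = ‖a − 1‖ · J₃` (hpref) enters linearly; the rest is the scalar identity of ★ p846176 (`levi_clause_scalar_identity`)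
  exact levi_clause_scalar_identity _ _ _ _ _ _ (c 0) (c 1) (c 2) hq hKH hpref

end Main

end Literature.NumberTheory.Rogawski1990

end
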